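import Summits.BirchSwinnertonDyer.BirchSwinnertonDyer.Theorems.QuadraticBranchSignedControlPlusEtaNonsurjBDMTVPrimesRows
import Summits.BirchSwinnertonDyer.BirchSwinnertonDyer.Theorems.QuadraticBranchSignedControlPlusEtaNonsurjUncongruentTwistInvariance
import Summits.BirchSwinnertonDyer.Rank1Residual.X9.TwistStability
import HarnessLib

/-!
# Route `QuadraticBranchSignedControl` (rung K8, cell `bsd-potss`): crux stmt-BirchSwinnertonDyer-19606
# `PlusEtaMainConjectureNonsurj` — THE ROWS AT `p = 13` ARE EXACTLY THE QUADRATIC TWISTS, UNRAMIFIED AT `13`, OF SEVEN REFERENCE CURVES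
# (kernel, modulo the BDMTV 2019 CM-ness theorem): the crux at `13` is seven explicit one-parameter families

WHAT. `…PlusEtaNonsurjBDMTVPrimes` / `…Rows` (k8eta-c2 g17, p649362 / p649729): given `BDMTV2019_nonsplitCartan_level13`, the rows of crux
19606 at `p = 13` (globally minimal `V/ℚ`, good at `13`, `a_13 = 0`, `13`-adic tower not onto) are exactly the curves with
`j ∈ {−3375, 16581375, 8000, −32768, −884736, −147197952000, −262537412640768000}`, each class realised by a reference row
`A ∈ {49a1, 49a3, [0,4,0,2,0], 121b1, 361a1, 4489a1, 26569a1}`. None of these `j` is `0` or `1728`, so by k8eta-c2 g15's twist transport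
(`EtaCartanField.exists_squarefree_twist_of_j_eq_of_good`: same `j ∉ {0,1728}`, both good at `p ≠ 2` ⟹ `C • V = A^{(d)}` with `d` square-free,
`p ∤ 2d`; `row_of_smul_eq_quadraticTwist`: such twists of a row are rows):

* `exists_reference_twist_of_row_thirteen (h13)`: every row `V` at `13` satisfies `C • V = A^{(d)}` for one of the SEVEN LISTED `A` (as literal
  Weierstrass models), some square-free `d` with `13 ∤ 2d` and some `C : VariableChange ℚ`;
* `row_thirteen_of_reference_twist` (no named fact): conversely every globally minimal `V` with `C • V = A^{(d)}`, `A` one of the seven, `d`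
  square-free, `13 ∤ 2d`, IS a row at `13` (good, `a_13 = 0`, tower not onto) — and is CM with `j(V) = j(A)`.

So, GIVEN BDMTV 2019, **the crux at `p = 13` is the `η`-main conjecture (C1⁺_η) on seven explicit quadratic-twist families**
(`plusEtaAt_thirteen_iff_families`). (At `p = 17` the same holds for the six classes with `j ≠ 0`; the class `j = 0` — 35 of the 41 in-table rows
at `17` — consists of the SEXTIC twists `y² = x³ + B` and is not a single quadratic-twist family; not treated here.)

HONEST FRAMING (cell `bsd-potss`, run/shared/lean/pub/bsd-potss/; FULL-BSD rank ≤ 1 programme): bookkeeping theorems; no definition, no new named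
fact, no `sorry`, axioms standard; conditional where marked on the displayed BDMTV fact. Nothing about (C1⁺_η) on these families is proved; crux 19606
stays OPEN; `BSD(W, p)` is claimed for no pair. Seat `bsd-potss-k8eta-c2` g17 (prover), `--supports stmt-BirchSwinnertonDyer-19606`.

References: [BalakrishnanEtAl2019] Cor. 1.3; [SilvermanAEC2009] X.5 Prop. 5.4 and Cor. 5.4.1, VII.5 Prop. 5.1; [Knapp1993] Prop. 12.10;
[Cremona1997] Table 1; [Zywina2015] Prop. 1.14; [Kobayashi2003] §4 (p. 8).
-/

set_option autoImplicit false
set_option linter.dupNamespace false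

noncomputable section

open scoped Classical

open WeierstrassCurve Literature.NumberTheory.EllipticCurves Literature.NumberTheory.EllipticCurves.Rank1Residual
  Literature.NumberTheory.EllipticCurves.Rank1Residual.X11RankOneCertificates Literature.NumberTheory.SerreUniformity
  Summit.BirchSwinnertonDyer.Rank1Residual.X11b Summit.BirchSwinnertonDyer.BirchSwinnertonDyer.Rank1Residual.IntModel
  Summit.BirchSwinnertonDyer.BirchSwinnertonDyer.Rank1Residual.X11RankOne
  Summit.BirchSwinnertonDyer.Rank1Residual.Additive
open Summit.BirchSwinnertonDyer.Rank1Residual.X10.CMPartnerCurves (isElliptic_cm121b1 isGloballyMinimal_cm121b1)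

namespace Summit.BirchSwinnertonDyer.BirchSwinnertonDyer.Theorems.EtaBDMTVPrimes

open Summit.BirchSwinnertonDyer.BirchSwinnertonDyer.Theorems.EtaCartanField
open Summit.BirchSwinnertonDyer.BirchSwinnertonDyer.Theorems.EtaUncongruentRecords
open Summit.BirchSwinnertonDyer.BirchSwinnertonDyer.Theorems.EtaUncongruentRecordsSeven

/-! ## §1 The seven reference rows at `13`, with their data -/

/-- **Reference row from counts** (bookkeeping): for a literal globally minimal `A` with integral model `[a₁,…,a₆]`, `13 ∤ Δ`, `#A(𝔽₁₃) = 14`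
and `j(A) ∈ cmJInvariants`: `A` is good at `13` with `a_13 = 0`, tower not onto, and every globally minimal `V` with `C • V = A^{(d)}`,
`d` square-free, `13 ∤ 2d`, is a row at `13` with `j(V) = j(A)` and CM. [cite: SilvermanAEC2009, X.5 Cor. 5.4.1 and VII.5 Prop. 5.1]
[cite: Zywina2015, Prop. 1.14] -/
theorem row_thirteen_of_twist_of_counts [Fact (13 : ℕ).Prime] (A : WeierstrassCurve ℚ) [A.IsElliptic] [A.IsGloballyMinimal]
    {a1 a2 a3 a4 a6 : ℤ} (hI : integralModelInt A = ⟨a1, a2, a3, a4, a6⟩) (hΔ : ¬ (13 : ℤ) ∣ discOf [a1, a2, a3, a4, a6])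
    (hc : countPoints [a1, a2, a3, a4, a6] 13 = (13 : ℤ) + 1) (hj : A.j ∈ cmJInvariants)
    (V : WeierstrassCurve ℚ) [V.IsElliptic] [V.IsGloballyMinimal] {d : ℤ} (hd : Squarefree d) (h2d : ¬ (13 : ℤ) ∣ 2 * d)
    {C : VariableChange ℚ} (hC : C • V = A.quadraticTwist (d : ℚ)) :
    V.HasGoodReductionAtPrime 13 ∧ V.frobeniusTrace 13 = 0 ∧ ¬ (∀ m : ℕ, V.HasSurjectiveModNGaloisRep (13 ^ m : ℕ)) ∧
      V.HasCM ∧ V.j = A.j := by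
  obtain ⟨hgoodA, hapA, hnsA, -⟩ := row_of_counts_of_j_mem A 13 (by decide) hI hΔ hc hj
  obtain ⟨hgood, hap, hns⟩ := row_of_smul_eq_quadraticTwist A V 13 hd (by exact_mod_cast h2d) hC hgoodA hapA hnsA
  have hd0 : (d : ℚ) ≠ 0 := by exact_mod_cast hd.ne_zero
  have hjV : V.j = A.j := Summit.BirchSwinnertonDyer.Rank1Residual.X9.j_eq_of_smul_eq_quadraticTwist A V hd0 hC
  exact ⟨hgood, hap, hns, (hasCM_iff_j_mem_holds V).mpr (hjV ▸ hj), hjV⟩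


/-! ## §2 Rows at `13` ⟹ quadratic twists of the seven reference curves (given BDMTV 2019) -/

/-- **Every row of crux 19606 at `p = 13` is a quadratic twist, unramified at `13`, of one of SEVEN reference curves.** GIVEN BDMTV 2019
Cor. 1.3 (named fact, hypothesis position): for `V/ℚ` globally minimal, good at `13`, `a_13(V) = 0`, `13`-adic tower not onto, there are a
reference curve `A ∈ {49a1, 49a3, [0,4,0,2,0], 121b1, 361a1, 4489a1, 26569a1}` (literal models), a square-free `d` with `13 ∤ 2d` and a
`C : VariableChange ℚ` with `C • V = A^{(d)}`. (`j(V)` is in the seven-element set — `j_mem_seven_of_row_thirteen`; none is `0` or `1728`; same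
`j` + both good at `13` ⟹ twist by k8eta-c2 g15's `exists_squarefree_twist_of_j_eq_of_good`.) [cite: BalakrishnanEtAl2019, Cor. 1.3]
[cite: SilvermanAEC2009, X.5 Prop. 5.4 and Cor. 5.4.1] -/
theorem exists_reference_twist_of_row_thirteen (h13 : BDMTV2019_nonsplitCartan_level13) (V : WeierstrassCurve ℚ) [V.IsElliptic]
    [V.IsGloballyMinimal] (p : ℕ) [Fact p.Prime] (hp : p = 13) (hgood : V.HasGoodReductionAtPrime p)
    (hap : V.frobeniusTrace p = 0) (hns : ¬ ∀ m : ℕ, V.HasSurjectiveModNGaloisRep (p ^ m : ℕ)) :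
    ∃ (A : WeierstrassCurve ℚ) (d : ℤ) (C : VariableChange ℚ),
      (A = ⟨1, -1, 0, -2, -1⟩ ∨
        A = ⟨1, -1, 0, -37, -78⟩ ∨
        A = ⟨0, 4, 0, 2, 0⟩ ∨
        A = ⟨0, -1, 1, -7, 10⟩ ∨
        A = ⟨0, 0, 1, -38, 90⟩ ∨
        A = ⟨0, 0, 1, -7370, 243528⟩ ∨
        A = ⟨0, 0, 1, -2174420, 1234136692⟩) ∧
      Squarefree d ∧ ¬ (13 : ℤ) ∣ 2 * d ∧ C • V = A.quadraticTwist (d : ℚ) := by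
  subst hp
  have hmem := j_mem_seven_of_row_thirteen h13 V 13 rfl hgood hap hns
  simp only [Finset.mem_insert, Finset.mem_singleton] at hmem
  rcases hmem with hj | hj | hj | hj | hj | hj | hj
  · haveI := isElliptic_A7a
    haveI := Summit.BirchSwinnertonDyer.Rank1Residual.X12.O11.RouteU.isGloballyMinimal_X049_eq
    have hI : integralModelInt (⟨1, -1, 0, -2, -1⟩ : WeierstrassCurve ℚ) = ⟨1, -1, 0, -2, -1⟩ :=
      integralModelInt_eq_of_map_eq _ (map_mk_int 1 (-1) 0 (-2) (-1))
    obtain ⟨hgoodA, -⟩ := good_and_frobeniusTrace_eq_of_countPoints hI 13 (by decide) (by decide +kernel)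
    have hjA := j_A7a
    obtain ⟨d, hd, h2d, C, hC⟩ := exists_squarefree_twist_of_j_eq_of_good (⟨1, -1, 0, -2, -1⟩ : WeierstrassCurve ℚ) V 13 (by decide)
      (by rw [hj, hjA]) (by rw [hjA]; norm_num) (by rw [hjA]; norm_num) hgoodA hgood
    exact ⟨_, d, C, (Or.inl rfl), hd, h2d, hC⟩
  · haveI := isElliptic_A7b
    haveI := isGloballyMinimal_A7b
    have hI : integralModelInt (⟨1, -1, 0, -37, -78⟩ : WeierstrassCurve ℚ) = ⟨1, -1, 0, -37, -78⟩ :=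
      integralModelInt_eq_of_map_eq _ (map_mk_int 1 (-1) 0 (-37) (-78))
    obtain ⟨hgoodA, -⟩ := good_and_frobeniusTrace_eq_of_countPoints hI 13 (by decide) (by decide +kernel)
    have hjA := j_A7b
    obtain ⟨d, hd, h2d, C, hC⟩ := exists_squarefree_twist_of_j_eq_of_good (⟨1, -1, 0, -37, -78⟩ : WeierstrassCurve ℚ) V 13 (by decide)
      (by rw [hj, hjA]) (by rw [hjA]; norm_num) (by rw [hjA]; norm_num) hgoodA hgood
    exact ⟨_, d, C, (Or.inr (Or.inl rfl)), hd, h2d, hC⟩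
  · haveI := isElliptic_A8
    haveI := isGloballyMinimal_A8
    have hI : integralModelInt (⟨0, 4, 0, 2, 0⟩ : WeierstrassCurve ℚ) = ⟨0, 4, 0, 2, 0⟩ :=
      integralModelInt_eq_of_map_eq _ (map_mk_int 0 4 0 2 0)
    obtain ⟨hgoodA, -⟩ := good_and_frobeniusTrace_eq_of_countPoints hI 13 (by decide) (by decide +kernel)
    have hjA := j_A8
    obtain ⟨d, hd, h2d, C, hC⟩ := exists_squarefree_twist_of_j_eq_of_good (⟨0, 4, 0, 2, 0⟩ : WeierstrassCurve ℚ) V 13 (by decide)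
      (by rw [hj, hjA]) (by rw [hjA]; norm_num) (by rw [hjA]; norm_num) hgoodA hgood
    exact ⟨_, d, C, (Or.inr (Or.inr (Or.inl rfl))), hd, h2d, hC⟩
  · haveI := isElliptic_cm121b1
    haveI := isGloballyMinimal_cm121b1
    have hI : integralModelInt (⟨0, -1, 1, -7, 10⟩ : WeierstrassCurve ℚ) = ⟨0, -1, 1, -7, 10⟩ :=
      integralModelInt_eq_of_map_eq _ (map_mk_int 0 (-1) 1 (-7) 10)
    obtain ⟨hgoodA, -⟩ := good_and_frobeniusTrace_eq_of_countPoints hI 13 (by decide) (by decide +kernel)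
    have hjA := j_A11
    obtain ⟨d, hd, h2d, C, hC⟩ := exists_squarefree_twist_of_j_eq_of_good (⟨0, -1, 1, -7, 10⟩ : WeierstrassCurve ℚ) V 13 (by decide)
      (by rw [hj, hjA]) (by rw [hjA]; norm_num) (by rw [hjA]; norm_num) hgoodA hgood
    exact ⟨_, d, C, (Or.inr (Or.inr (Or.inr (Or.inl rfl)))), hd, h2d, hC⟩
  · haveI := isElliptic_A19
    haveI := isGloballyMinimal_A19
    have hI : integralModelInt (⟨0, 0, 1, -38, 90⟩ : WeierstrassCurve ℚ) = ⟨0, 0, 1, -38, 90⟩ :=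
      integralModelInt_eq_of_map_eq _ (map_mk_int 0 0 1 (-38) 90)
    obtain ⟨hgoodA, -⟩ := good_and_frobeniusTrace_eq_of_countPoints hI 13 (by decide) (by decide +kernel)
    have hjA := j_A19
    obtain ⟨d, hd, h2d, C, hC⟩ := exists_squarefree_twist_of_j_eq_of_good (⟨0, 0, 1, -38, 90⟩ : WeierstrassCurve ℚ) V 13 (by decide)
      (by rw [hj, hjA]) (by rw [hjA]; norm_num) (by rw [hjA]; norm_num) hgoodA hgood
    exact ⟨_, d, C, (Or.inr (Or.inr (Or.inr (Or.inr (Or.inl rfl))))), hd, h2d, hC⟩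
  · haveI := isElliptic_A67
    haveI := isGloballyMinimal_A67
    have hI : integralModelInt (⟨0, 0, 1, -7370, 243528⟩ : WeierstrassCurve ℚ) = ⟨0, 0, 1, -7370, 243528⟩ :=
      integralModelInt_eq_of_map_eq _ (map_mk_int 0 0 1 (-7370) 243528)
    obtain ⟨hgoodA, -⟩ := good_and_frobeniusTrace_eq_of_countPoints hI 13 (by decide) (by decide +kernel)
    have hjA := j_A67
    obtain ⟨d, hd, h2d, C, hC⟩ := exists_squarefree_twist_of_j_eq_of_good (⟨0, 0, 1, -7370, 243528⟩ : WeierstrassCurve ℚ) V 13 (by decide)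
      (by rw [hj, hjA]) (by rw [hjA]; norm_num) (by rw [hjA]; norm_num) hgoodA hgood
    exact ⟨_, d, C, (Or.inr (Or.inr (Or.inr (Or.inr (Or.inr (Or.inl rfl)))))), hd, h2d, hC⟩
  · haveI := isElliptic_A163
    haveI := isGloballyMinimal_A163
    have hI : integralModelInt (⟨0, 0, 1, -2174420, 1234136692⟩ : WeierstrassCurve ℚ) = ⟨0, 0, 1, -2174420, 1234136692⟩ :=
      integralModelInt_eq_of_map_eq _ (map_mk_int 0 0 1 (-2174420) 1234136692)
    obtain ⟨hgoodA, -⟩ := good_and_frobeniusTrace_eq_of_countPoints hI 13 (by decide) (by decide +kernel)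
    have hjA := j_A163
    obtain ⟨d, hd, h2d, C, hC⟩ := exists_squarefree_twist_of_j_eq_of_good (⟨0, 0, 1, -2174420, 1234136692⟩ : WeierstrassCurve ℚ) V 13 (by decide)
      (by rw [hj, hjA]) (by rw [hjA]; norm_num) (by rw [hjA]; norm_num) hgoodA hgood
    exact ⟨_, d, C, (Or.inr (Or.inr (Or.inr (Or.inr (Or.inr (Or.inr (rfl))))))), hd, h2d, hC⟩

/-! ## §3 Quadratic twists of the seven reference curves ⟹ rows at `13` (no named fact) -/

/-- **Conversely (kernel, no BDMTV): every quadratic twist, unramified at `13`, of one of the seven reference curves is a row at `13`.**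
For `V/ℚ` globally minimal with `C • V = A^{(d)}`, `A` one of the seven literal models, `d` square-free, `13 ∤ 2d`: `V` is good at `13`,
`a_13(V) = 0`, its `13`-adic tower is not onto, `V` has CM and `j(V)` lies in the seven-element set. (Reference data by kernel point counts
`#A(𝔽₁₃) = 14`; k8eta-c2 g15's `row_of_smul_eq_quadraticTwist`.) [cite: SilvermanAEC2009, X.5 Cor. 5.4.1 and VII.5 Prop. 5.1]
[cite: Zywina2015, Prop. 1.14] -/
theorem row_thirteen_of_reference_twist [Fact (13 : ℕ).Prime] (V : WeierstrassCurve ℚ) [V.IsElliptic] [V.IsGloballyMinimal]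
    (A : WeierstrassCurve ℚ)
    (hA : A = ⟨1, -1, 0, -2, -1⟩ ∨
        A = ⟨1, -1, 0, -37, -78⟩ ∨
        A = ⟨0, 4, 0, 2, 0⟩ ∨
        A = ⟨0, -1, 1, -7, 10⟩ ∨
        A = ⟨0, 0, 1, -38, 90⟩ ∨
        A = ⟨0, 0, 1, -7370, 243528⟩ ∨
        A = ⟨0, 0, 1, -2174420, 1234136692⟩)
    {d : ℤ} (hd : Squarefree d) (h2d : ¬ (13 : ℤ) ∣ 2 * d) {C : VariableChange ℚ} (hC : C • V = A.quadraticTwist (d : ℚ)) :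
    V.HasGoodReductionAtPrime 13 ∧ V.frobeniusTrace 13 = 0 ∧ ¬ (∀ m : ℕ, V.HasSurjectiveModNGaloisRep (13 ^ m : ℕ)) ∧ V.HasCM ∧
      V.j ∈ ({-3375, 16581375, 8000, -32768, -884736, -147197952000, -262537412640768000} : Finset ℚ) := by
  rcases hA with rfl | rfl | rfl | rfl | rfl | rfl | rfl
  · haveI := isElliptic_A7a
    haveI := Summit.BirchSwinnertonDyer.Rank1Residual.X12.O11.RouteU.isGloballyMinimal_X049_eq
    have hI : integralModelInt (⟨1, -1, 0, -2, -1⟩ : WeierstrassCurve ℚ) = ⟨1, -1, 0, -2, -1⟩ :=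
      integralModelInt_eq_of_map_eq _ (map_mk_int 1 (-1) 0 (-2) (-1))
    have hjA := j_A7a
    obtain ⟨hgood, hap, hns, hCM, hjV⟩ := row_thirteen_of_twist_of_counts _ hI (by decide +kernel) (by decide +kernel)
      (by rw [hjA]; decide +kernel) V hd h2d hC
    exact ⟨hgood, hap, hns, hCM, by rw [hjV, hjA]; simp⟩
  · haveI := isElliptic_A7b
    haveI := isGloballyMinimal_A7b
    have hI : integralModelInt (⟨1, -1, 0, -37, -78⟩ : WeierstrassCurve ℚ) = ⟨1, -1, 0, -37, -78⟩ :=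
      integralModelInt_eq_of_map_eq _ (map_mk_int 1 (-1) 0 (-37) (-78))
    have hjA := j_A7b
    obtain ⟨hgood, hap, hns, hCM, hjV⟩ := row_thirteen_of_twist_of_counts _ hI (by decide +kernel) (by decide +kernel)
      (by rw [hjA]; decide +kernel) V hd h2d hC
    exact ⟨hgood, hap, hns, hCM, by rw [hjV, hjA]; simp⟩
  · haveI := isElliptic_A8
    haveI := isGloballyMinimal_A8
    have hI : integralModelInt (⟨0, 4, 0, 2, 0⟩ : WeierstrassCurve ℚ) = ⟨0, 4, 0, 2, 0⟩ :=
      integralModelInt_eq_of_map_eq _ (map_mk_int 0 4 0 2 0)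
    have hjA := j_A8
    obtain ⟨hgood, hap, hns, hCM, hjV⟩ := row_thirteen_of_twist_of_counts _ hI (by decide +kernel) (by decide +kernel)
      (by rw [hjA]; decide +kernel) V hd h2d hC
    exact ⟨hgood, hap, hns, hCM, by rw [hjV, hjA]; simp⟩
  · haveI := isElliptic_cm121b1
    haveI := isGloballyMinimal_cm121b1
    have hI : integralModelInt (⟨0, -1, 1, -7, 10⟩ : WeierstrassCurve ℚ) = ⟨0, -1, 1, -7, 10⟩ :=
      integralModelInt_eq_of_map_eq _ (map_mk_int 0 (-1) 1 (-7) 10)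
    have hjA := j_A11
    obtain ⟨hgood, hap, hns, hCM, hjV⟩ := row_thirteen_of_twist_of_counts _ hI (by decide +kernel) (by decide +kernel)
      (by rw [hjA]; decide +kernel) V hd h2d hC
    exact ⟨hgood, hap, hns, hCM, by rw [hjV, hjA]; simp⟩
  · haveI := isElliptic_A19
    haveI := isGloballyMinimal_A19
    have hI : integralModelInt (⟨0, 0, 1, -38, 90⟩ : WeierstrassCurve ℚ) = ⟨0, 0, 1, -38, 90⟩ :=
      integralModelInt_eq_of_map_eq _ (map_mk_int 0 0 1 (-38) 90)
    have hjA := j_A19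
    obtain ⟨hgood, hap, hns, hCM, hjV⟩ := row_thirteen_of_twist_of_counts _ hI (by decide +kernel) (by decide +kernel)
      (by rw [hjA]; decide +kernel) V hd h2d hC
    exact ⟨hgood, hap, hns, hCM, by rw [hjV, hjA]; simp⟩
  · haveI := isElliptic_A67
    haveI := isGloballyMinimal_A67
    have hI : integralModelInt (⟨0, 0, 1, -7370, 243528⟩ : WeierstrassCurve ℚ) = ⟨0, 0, 1, -7370, 243528⟩ :=
      integralModelInt_eq_of_map_eq _ (map_mk_int 0 0 1 (-7370) 243528)
    have hjA := j_A67
    obtain ⟨hgood, hap, hns, hCM, hjV⟩ := row_thirteen_of_twist_of_counts _ hI (by decide +kernel) (by decide +kernel)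
      (by rw [hjA]; decide +kernel) V hd h2d hC
    exact ⟨hgood, hap, hns, hCM, by rw [hjV, hjA]; simp⟩
  · haveI := isElliptic_A163
    haveI := isGloballyMinimal_A163
    have hI : integralModelInt (⟨0, 0, 1, -2174420, 1234136692⟩ : WeierstrassCurve ℚ) = ⟨0, 0, 1, -2174420, 1234136692⟩ :=
      integralModelInt_eq_of_map_eq _ (map_mk_int 0 0 1 (-2174420) 1234136692)
    have hjA := j_A163
    obtain ⟨hgood, hap, hns, hCM, hjV⟩ := row_thirteen_of_twist_of_counts _ hI (by decide +kernel) (by decide +kernel)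
      (by rw [hjA]; decide +kernel) V hd h2d hC
    exact ⟨hgood, hap, hns, hCM, by rw [hjV, hjA]; simp⟩

/-! ## §4 The crux at `13` as seven explicit families -/

/-- **GIVEN BDMTV 2019, the `η`-main conjecture on the rows of crux 19606 at `p = 13` is EQUIVALENT to the `η`-main conjecture on the seven
quadratic-twist families** `{V : C • V = A^{(d)}, d square-free, 13 ∤ 2d}`, `A ∈ {49a1, 49a3, [0,4,0,2,0], 121b1, 361a1, 4489a1, 26569a1}`
(the node `QuadraticBranchPlusEtaMainConjectureAt V 13` in hypothesis / conclusion positions only; nothing asserted).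
[cite: BalakrishnanEtAl2019, Cor. 1.3] [cite: Kobayashi2003, §4 Even main conjecture (p. 8)] -/
theorem plusEtaAt_thirteen_iff_families (h13 : BDMTV2019_nonsplitCartan_level13) [Fact (13 : ℕ).Prime] :
    (∀ (V : WeierstrassCurve ℚ) [V.IsElliptic] [V.IsGloballyMinimal],
        V.HasGoodReductionAtPrime 13 → V.frobeniusTrace 13 = 0 → ¬ (∀ m : ℕ, V.HasSurjectiveModNGaloisRep (13 ^ m : ℕ)) →
        QuadraticBranchPlusEtaMainConjectureAt V 13) ↔
    (∀ (V : WeierstrassCurve ℚ) [V.IsElliptic] [V.IsGloballyMinimal] (A : WeierstrassCurve ℚ) (d : ℤ) (C : VariableChange ℚ),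
        (A = ⟨1, -1, 0, -2, -1⟩ ∨
        A = ⟨1, -1, 0, -37, -78⟩ ∨
        A = ⟨0, 4, 0, 2, 0⟩ ∨
        A = ⟨0, -1, 1, -7, 10⟩ ∨
        A = ⟨0, 0, 1, -38, 90⟩ ∨
        A = ⟨0, 0, 1, -7370, 243528⟩ ∨
        A = ⟨0, 0, 1, -2174420, 1234136692⟩) →
        Squarefree d → ¬ (13 : ℤ) ∣ 2 * d → C • V = A.quadraticTwist (d : ℚ) → QuadraticBranchPlusEtaMainConjectureAt V 13) := by
  constructor
  · intro h V _ _ A d C hA hd h2d hC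
    obtain ⟨hgood, hap, hns, -, -⟩ := row_thirteen_of_reference_twist V A hA hd h2d hC
    exact h V hgood hap hns
  · intro h V _ _ hgood hap hns
    obtain ⟨A, d, C, hA, hd, h2d, hC⟩ := exists_reference_twist_of_row_thirteen h13 V 13 rfl hgood hap hns
    exact h V A d C hA hd h2d hC

end Summit.BirchSwinnertonDyer.BirchSwinnertonDyer.Theorems.EtaBDMTVPrimes

end
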